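import Summits.HodgeConjecture.CorCM.IrreducibleOddWeightsBlockHelly
import HarnessLib

/-!
# BLOCKS ARE MEMBERS (CM fields): `Hg(∏_i A_i) = ∏_c Hg(X_c)` (`X_c = ∏_{κ i = c} A_i`) is decided on sets of at most
# `max_c dim Hg(X_c) + 1` blocks — or `[Gal(L/ℚ) : A] + 1` blocks, or PAIRS of blocks when `Gal(L/ℚ)` is abelian — and a
# minimal block-non-additive set of blocks `C₀` has `|C₀| ≤ dim MT(X_c)` for EVERY block `c ∈ C₀`

COR-CM (cell `pub-hodgecm2`, binder seat `b16` gen 61, count-neutral claim BLOCKS ARE MEMBERS, file H2 — CM fields;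
theorems only, no definition, no named fact, no `sorry`).  NEW as stated, hence under `Summits/`.  HONEST FRAMING:
statements about Deligne's ranks `cmFamilyRank` of families of CM types of CM fields (`= dim MT` of the corresponding
products of CM abelian varieties, Deligne LNM 900 I Ex. 3.7 (c) — the tree's dictionary, not used here); `HC_CM` is
neither used nor asserted.

The abstract file `IrreducibleOddWeightsBlockHelly` read with `G = Aut(ℂ)`, `E_i = Hom(K_i, ℂ)`, `ρ` = complex
conjugation.  CM fields `K_i` (`i ∈ I` finite), ARBITRARY CM types `Φ_i` (degenerate, Weil-type … allowed), a partition
`κ : I ↠ C` into blocks; «block additive» = `cmFamilyRank Φ + |C| = Σ_c cmFamilyRank Φ|_{κ = c} + 1`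
(`Hg(∏_i A_i) = ∏_c Hg(X_c)`), and for a set of blocks `T`, «`T` block additive» =
`cmFamilyRank Φ|_{κ ∈ T} + |T| = Σ_{c ∈ T} cmFamilyRank Φ|_{κ = c} + 1` (`Hg(∏_{c ∈ T} X_c) = ∏_{c ∈ T} Hg(X_c)`):

* **`cmFamilyRank_fiber_add_card_eq_iff_forall_card_le_of_cmFamilyRank_le`** — `dim MT(X_c) ≤ q + 1` for all blocks ⟹
  block additive IFF every non-empty set of at most `q + 1` blocks is; **`…_of_finrank_le`** (`dim X_c ≤ q` suffices:
  blocks of dimension `≤ q` interact `q + 1` at a time); `exists_card_le_cmFamilyRank_fiber_add_card_ne`.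
* **`cmFamilyRank_fiber_add_card_eq_iff_forall_card_le_index_succ`** — `K_i ↪ L` Galois, `A ≤ Gal(L/ℚ)` with pairwise
  commuting elements: sets of at most `[Gal(L/ℚ) : A] + 1` blocks decide; **`…_two_of_comm`** — `Gal(L/ℚ)` ABELIAN: PAIRS
  OF BLOCKS `Hg(X_c × X_{c'}) = Hg(X_c) × Hg(X_{c'})` decide `Hg(∏_c X_c) = ∏_c Hg(X_c)`.
* **`card_le_cmFamilyRank_fiber_of_minimal`** — a minimal block-non-additive set of blocks `C₀` has
  `|C₀| ≤ cmFamilyRank Φ|_{κ = c} = dim MT(X_c)` for EVERY `c ∈ C₀`; `exists_minimal_cmFamilyRank_fiber_add_card_ne`;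
  `card_le_two_of_minimal_of_cmFamilyRank_fiber_le_two` (a block with `dim Hg ≤ 1` meets at most one other block in a
  minimal interaction).

With `κ = id` these are gen 59's `IrreducibleOddWeightsAdditivityHellyCMFields`; here NOTHING is assumed inside a block.

## References

* [MoonenZarhin1999LowDim] B. Moonen, Yu. Zarhin, *Hodge classes on abelian varieties of low dimension*, Math. Ann.
  315 (1999), §3 (3.1), Remark (3.9).
* [Mai1989] L. Mai, *Lower bounds for the ranks of CM types*, J. Number Theory 32 (1989), §2 Prop. 1 (proof).
* [Gordon1999HodgeAVSurvey] B. B. Gordon, *A survey of the Hodge conjecture for abelian varieties*, §3 Theorem (Imai,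
  Murty) with proof; 7.5–7.7.
* [Serre1977] J.-P. Serre, *Linear Representations of Finite Groups*, GTM 42 (1977), §3.1 Cor. to Thm. 9.
* [Shimura1998] G. Shimura, *Abelian Varieties with Complex Multiplication and Modular Functions* (1998), §8.1,
  §32.10.
* [Deligne1982HodgeCycles] P. Deligne, *Hodge cycles on abelian varieties*, LNM 900 (1982), I Ex. 3.7.
-/

set_option autoImplicit false

noncomputable section

open scoped BigOperators

open NumberField

namespace Summit.HodgeConjecture.CorCM

/-! ### §1 CM fields: `Hg(∏_i A_i) = ∏_c Hg(X_c)` is decided on few blocks, and minimal failures are small -/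

open Literature.NumberTheory.ComplexMultiplication
open Literature.AlgebraicGeometry.Motives (CMType)
open Literature.AlgebraicGeometry.Pohlmann1968

variable {I : Type} [Fintype I] {K : I → Type} [∀ i, Field (K i)] [∀ i, NumberField (K i)] [∀ i, IsCMField (K i)]
  {C : Type} [Fintype C] [DecidableEq C] {L : Type} [Field L] [NumberField L] [Normal ℚ L]

/-- **`Hg(∏_i A_i) = ∏_c Hg(X_c)` IS DECIDED ON SETS OF AT MOST `q + 1` BLOCKS, `q ≥ max_c dim Hg(X_c)`.**  CM fields
`K_i`, ARBITRARY CM types `Φ_i` (degenerate allowed), a partition `κ : I ↠ C` of the index set into blocks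
`X_c = ∏_{κ i = c} A_i` with `dim MT(X_c) = cmFamilyRank Φ|_{κ = c} ≤ q + 1`.  Then block additivity
`cmFamilyRank Φ + |C| = Σ_c cmFamilyRank Φ|_{κ = c} + 1` holds IFF it holds for the sub-family over every non-empty set of
at most `q + 1` blocks.  Nothing is assumed inside a block. [cite: MoonenZarhin1999LowDim, §3 (3.1)]
[cite: Mai1989, §2 Prop. 1 (proof)] [cite: Gordon1999HodgeAVSurvey, 7.7] -/
theorem cmFamilyRank_fiber_add_card_eq_iff_forall_card_le_of_cmFamilyRank_le [Nonempty I] (Φ : ∀ i, CMType (K i))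
    (κ : I → C) (hκ : Function.Surjective κ) (q : ℕ)
    (hq : ∀ c, CMAlgebra.cmFamilyRank (fun i : {i // κ i = c} => Φ i.1) ≤ q + 1) :
    CMAlgebra.cmFamilyRank Φ + Fintype.card C = (∑ c, CMAlgebra.cmFamilyRank fun i : {i // κ i = c} => Φ i.1) + 1 ↔
      ∀ T : Finset C, T.Nonempty → T.card ≤ q + 1 →
        CMAlgebra.cmFamilyRank (fun i : {i // κ i ∈ T} => Φ i.1) + T.card =
          (∑ c ∈ T, CMAlgebra.cmFamilyRank fun i : {i // κ i = c} => Φ i.1) + 1 := by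
  haveI : ∀ i, Nonempty (K i →+* ℂ) := fun i => inferInstance
  exact IrrOdd.typeRank_sigmaType_add_card_eq_sum_fiber_iff_forall_card_le_of_typeRank_le (G := ℂ ≃+* ℂ)
    (E := fun i => K i →+* ℂ) (Φ := fun i => (Φ i).1) (fun i => isCMTypeWith_conj (Φ i)) κ hκ q hq

/-- **`dim X_c ≤ q` for every block suffices** (`dim MT(X_c) ≤ dim X_c + 1`): for blocks of dimension `≤ q`,
`Hg(∏_i A_i) = ∏_c Hg(X_c)` iff so over every set of at most `q + 1` blocks. [cite: Shimura1998, §32.10 Prop.]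
[cite: MoonenZarhin1999LowDim, §3 (3.1)] -/
theorem cmFamilyRank_fiber_add_card_eq_iff_forall_card_le_of_finrank_le [Nonempty I] (Φ : ∀ i, CMType (K i))
    (κ : I → C) (hκ : Function.Surjective κ) (q : ℕ)
    (hq : ∀ c, (∑ i : {i // κ i = c}, Module.finrank ℚ (K i.1)) ≤ 2 * q) :
    CMAlgebra.cmFamilyRank Φ + Fintype.card C = (∑ c, CMAlgebra.cmFamilyRank fun i : {i // κ i = c} => Φ i.1) + 1 ↔
      ∀ T : Finset C, T.Nonempty → T.card ≤ q + 1 →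
        CMAlgebra.cmFamilyRank (fun i : {i // κ i ∈ T} => Φ i.1) + T.card =
          (∑ c ∈ T, CMAlgebra.cmFamilyRank fun i : {i // κ i = c} => Φ i.1) + 1 := by
  refine cmFamilyRank_fiber_add_card_eq_iff_forall_card_le_of_cmFamilyRank_le Φ κ hκ q fun c => ?_
  obtain ⟨i₁, hi₁⟩ := hκ c
  haveI : Nonempty {i // κ i = c} := ⟨⟨i₁, hi₁⟩⟩
  have h1 := CMAlgebra.cmFamilyRank_le (fun i : {i // κ i = c} => Φ i.1)
  have h2 := hq c
  omega

/-- **A block-non-additive partition has a block-non-additive set of at most `q + 1` blocks** (`dim MT(X_c) ≤ q + 1`):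
`Hg(∏_i A_i) ⊊ ∏_c Hg(X_c)` is witnessed on at most `q + 1` of the `X_c`. [cite: MoonenZarhin1999LowDim, §3 (3.1)]
[cite: Mai1989, §2 Prop. 1 (proof)] -/
theorem exists_card_le_cmFamilyRank_fiber_add_card_ne [Nonempty I] (Φ : ∀ i, CMType (K i)) (κ : I → C)
    (hκ : Function.Surjective κ) (q : ℕ)
    (hq : ∀ c, CMAlgebra.cmFamilyRank (fun i : {i // κ i = c} => Φ i.1) ≤ q + 1)
    (hnot : CMAlgebra.cmFamilyRank Φ + Fintype.card C ≠
      (∑ c, CMAlgebra.cmFamilyRank fun i : {i // κ i = c} => Φ i.1) + 1) :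
    ∃ T : Finset C, T.Nonempty ∧ T.card ≤ q + 1 ∧
      CMAlgebra.cmFamilyRank (fun i : {i // κ i ∈ T} => Φ i.1) + T.card ≠
        (∑ c ∈ T, CMAlgebra.cmFamilyRank fun i : {i // κ i = c} => Φ i.1) + 1 := by
  haveI : ∀ i, Nonempty (K i →+* ℂ) := fun i => inferInstance
  exact IrrOdd.exists_card_le_typeRank_sigmaType_add_card_ne_sum_fiber (G := ℂ ≃+* ℂ) (E := fun i => K i →+* ℂ)
    (Φ := fun i => (Φ i).1) (fun i => isCMTypeWith_conj (Φ i)) κ hκ q hq hnot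

/-- **THE INDEX FORM FOR BLOCKS**: `K_i ↪ L` Galois over `ℚ`, `A ≤ Gal(L/ℚ)` with pairwise commuting elements ⟹
`Hg(∏_i A_i) = ∏_c Hg(X_c)` iff so over every set of at most `[Gal(L/ℚ) : A] + 1` blocks (arbitrary CM types, arbitrary
blocks). [cite: Serre1977, §3.1 Cor. to Thm. 9] [cite: MoonenZarhin1999LowDim, §3 (3.1)] [cite: Shimura1998, §8.1] -/
theorem cmFamilyRank_fiber_add_card_eq_iff_forall_card_le_index_succ [Nonempty I] (ι : L →+* ℂ)
    (e : ∀ i, K i →+* L) (Φ : ∀ i, CMType (K i)) (κ : I → C) (hκ : Function.Surjective κ)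
    (A : Subgroup (L ≃ₐ[ℚ] L)) (hA : ∀ a ∈ A, ∀ b ∈ A, a * b = b * a) :
    CMAlgebra.cmFamilyRank Φ + Fintype.card C = (∑ c, CMAlgebra.cmFamilyRank fun i : {i // κ i = c} => Φ i.1) + 1 ↔
      ∀ T : Finset C, T.Nonempty → T.card ≤ A.index + 1 →
        CMAlgebra.cmFamilyRank (fun i : {i // κ i ∈ T} => Φ i.1) + T.card =
          (∑ c ∈ T, CMAlgebra.cmFamilyRank fun i : {i // κ i = c} => Φ i.1) + 1 := by
  classical
  obtain ⟨r, hr, hsurj⟩ := exists_restrictHom ι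
  haveI : ∀ i, Nonempty (K i →+* ℂ) := fun i => inferInstance
  have hindex : (A.comap r).index = A.index := A.index_comap_of_surjective hsurj
  haveI : (A.comap r).FiniteIndex := ⟨by rw [hindex]; exact Subgroup.FiniteIndex.index_ne_zero⟩
  have key := IrrOdd.typeRank_sigmaType_add_card_eq_sum_fiber_iff_forall_card_le_index_succ_of_smul_comm
    (G := ℂ ≃+* ℂ) (E := fun i => K i →+* ℂ) (Φ := fun i => (Φ i).1) (fun i => isCMTypeWith_conj (Φ i)) κ hκ
    (A.comap r) (smul_comm_of_comap_restrictHom ι e hr A hA)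
  rw [hindex] at key
  exact key

/-- **`Gal(L/ℚ)` ABELIAN: PAIRS OF BLOCKS DECIDE** — `Hg(∏_c X_c) = ∏_c Hg(X_c)` iff `Hg(X_c × X_{c'}) = Hg(X_c) × Hg(X_{c'})`
for all pairs of blocks `c, c'`; arbitrary CM types of subfields of `L`, arbitrary blocks (products of CM elliptic curves,
Weil-type pairs, …). [cite: Gordon1999HodgeAVSurvey, §3 Theorem and 7.5–7.7] [cite: MoonenZarhin1999LowDim, §3 (3.1) and Remark (3.9)] -/
theorem cmFamilyRank_fiber_add_card_eq_iff_forall_card_le_two_of_comm [Nonempty I] (ι : L →+* ℂ)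
    (e : ∀ i, K i →+* L) (Φ : ∀ i, CMType (K i)) (κ : I → C) (hκ : Function.Surjective κ)
    (hG : ∀ a b : L ≃ₐ[ℚ] L, a * b = b * a) :
    CMAlgebra.cmFamilyRank Φ + Fintype.card C = (∑ c, CMAlgebra.cmFamilyRank fun i : {i // κ i = c} => Φ i.1) + 1 ↔
      ∀ T : Finset C, T.Nonempty → T.card ≤ 2 →
        CMAlgebra.cmFamilyRank (fun i : {i // κ i ∈ T} => Φ i.1) + T.card =
          (∑ c ∈ T, CMAlgebra.cmFamilyRank fun i : {i // κ i = c} => Φ i.1) + 1 := by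
  have key := cmFamilyRank_fiber_add_card_eq_iff_forall_card_le_index_succ ι e Φ κ hκ ⊤ fun a _ b _ => hG a b
  rwa [Subgroup.index_top] at key

/-- **MINIMAL BLOCK-NON-ADDITIVE SETS OF BLOCKS ARE SMALL: `|C₀| ≤ cmFamilyRank Φ|_{κ = c} = dim MT(X_c)` FOR EVERY
BLOCK `c ∈ C₀`.**  If `Hg(∏_{c ∈ C₀} X_c) ⊊ ∏_{c ∈ C₀} Hg(X_c)` while every non-empty proper set of blocks of `C₀` is block
additive, then every block of `C₀` has `dim Hg(X_c) ≥ |C₀| − 1`.  Arbitrary CM types, arbitrary blocks.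
[cite: MoonenZarhin1999LowDim, §3 (3.1)] [cite: Mai1989, §2 Prop. 1 (proof)] [cite: Shimura1998, §32.10 Prop.] -/
theorem card_le_cmFamilyRank_fiber_of_minimal (Φ : ∀ i, CMType (K i)) (κ : I → C) (hκ : Function.Surjective κ)
    (C₀ : Finset C)
    (hnot : CMAlgebra.cmFamilyRank (fun i : {i // κ i ∈ C₀} => Φ i.1) + C₀.card ≠
      (∑ c ∈ C₀, CMAlgebra.cmFamilyRank fun i : {i // κ i = c} => Φ i.1) + 1)
    (hmin : ∀ T : Finset C, T ⊂ C₀ → T.Nonempty →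
      CMAlgebra.cmFamilyRank (fun i : {i // κ i ∈ T} => Φ i.1) + T.card =
        (∑ c ∈ T, CMAlgebra.cmFamilyRank fun i : {i // κ i = c} => Φ i.1) + 1)
    {c : C} (hc : c ∈ C₀) : C₀.card ≤ CMAlgebra.cmFamilyRank fun i : {i // κ i = c} => Φ i.1 := by
  haveI : ∀ i, Nonempty (K i →+* ℂ) := fun i => inferInstance
  exact IrrOdd.card_le_typeRank_fiber_of_minimal (G := ℂ ≃+* ℂ) (E := fun i => K i →+* ℂ)
    (Φ := fun i => (Φ i).1) (fun i => isCMTypeWith_conj (Φ i)) κ hκ C₀ hnot hmin hc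

/-- **If `Hg(∏_i A_i) ⊊ ∏_c Hg(X_c)` there is a MINIMAL block-non-additive set of blocks `C₀`, with `|C₀| ≤ dim MT(X_c)` for
every `c ∈ C₀`.** [cite: MoonenZarhin1999LowDim, §3 (3.1)] [cite: Mai1989, §2 Prop. 1 (proof)] -/
theorem exists_minimal_cmFamilyRank_fiber_add_card_ne [Nonempty I] (Φ : ∀ i, CMType (K i)) (κ : I → C)
    (hκ : Function.Surjective κ)
    (hnot : CMAlgebra.cmFamilyRank Φ + Fintype.card C ≠
      (∑ c, CMAlgebra.cmFamilyRank fun i : {i // κ i = c} => Φ i.1) + 1) :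
    ∃ C₀ : Finset C, C₀.Nonempty ∧
      CMAlgebra.cmFamilyRank (fun i : {i // κ i ∈ C₀} => Φ i.1) + C₀.card ≠
        (∑ c ∈ C₀, CMAlgebra.cmFamilyRank fun i : {i // κ i = c} => Φ i.1) + 1 ∧
      (∀ T : Finset C, T ⊂ C₀ → T.Nonempty →
        CMAlgebra.cmFamilyRank (fun i : {i // κ i ∈ T} => Φ i.1) + T.card =
          (∑ c ∈ T, CMAlgebra.cmFamilyRank fun i : {i // κ i = c} => Φ i.1) + 1) ∧
      ∀ c ∈ C₀, C₀.card ≤ CMAlgebra.cmFamilyRank fun i : {i // κ i = c} => Φ i.1 := by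
  haveI : ∀ i, Nonempty (K i →+* ℂ) := fun i => inferInstance
  exact IrrOdd.exists_minimal_typeRank_fiber_add_card_ne (G := ℂ ≃+* ℂ) (E := fun i => K i →+* ℂ)
    (Φ := fun i => (Φ i).1) (fun i => isCMTypeWith_conj (Φ i)) κ hκ hnot

/-- **A block `X_c` with `dim Hg(X_c) ≤ 1` (e.g. a power of one CM elliptic curve, `cmFamilyRank = 2`) takes part in no
minimal block interaction of more than two blocks.** [cite: MoonenZarhin1999LowDim, §3 (3.1)] [cite: Gordon1999HodgeAVSurvey, §3 and 7.7] -/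
theorem card_le_two_of_minimal_of_cmFamilyRank_fiber_le_two (Φ : ∀ i, CMType (K i)) (κ : I → C)
    (hκ : Function.Surjective κ) (C₀ : Finset C)
    (hnot : CMAlgebra.cmFamilyRank (fun i : {i // κ i ∈ C₀} => Φ i.1) + C₀.card ≠
      (∑ c ∈ C₀, CMAlgebra.cmFamilyRank fun i : {i // κ i = c} => Φ i.1) + 1)
    (hmin : ∀ T : Finset C, T ⊂ C₀ → T.Nonempty →
      CMAlgebra.cmFamilyRank (fun i : {i // κ i ∈ T} => Φ i.1) + T.card =
        (∑ c ∈ T, CMAlgebra.cmFamilyRank fun i : {i // κ i = c} => Φ i.1) + 1)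
    {c : C} (hc : c ∈ C₀) (hrank : CMAlgebra.cmFamilyRank (fun i : {i // κ i = c} => Φ i.1) ≤ 2) : C₀.card ≤ 2 :=
  (card_le_cmFamilyRank_fiber_of_minimal Φ κ hκ C₀ hnot hmin hc).trans hrank

end Summit.HodgeConjecture.CorCM

end
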